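import Literature.AnabelianGeometry.SemiGraphs.TemperedPiTowerNonabelianLevel
import Literature.AnabelianGeometry.SemiGraphs.TemperedGroupsLimitFinite
import HarnessLib

/-!
# `π₁^temp(𝒢)` is compact when `𝒢` has no closed edge: the André tower input holds
# iff `𝒢` has a closed edge ([SemiAnbd] Prop. 3.6 p. 38; §1 p. 12; [André 2003] §4.5)

Mochizuki, *Semi-graphs of anabelioids*, Publ. RIMS **42** (2006) [SemiAnbd], Prop. 3.6 p. 38:
"`π₁^temp(𝒢) := lim_i Gal(𝒢_{∞,i}/𝒢)`" over a cofinal system of connected finite étale Galois coverings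
`𝒢_i → 𝒢`, with `𝒢_{∞,i}` "the [tempered] covering determined by the universal graph-covering of the
underlying semi-graph `𝔾_i` of `𝒢_i`"; §1 p. 12 (closed / open edges); §1 p. 20 ("the fundamental group
of any graph is free"). [cite: MochizukiSemiAnbd2006, Prop 3.6 p.38]

PROOF-ONLY file (abc-iut cell, prover abc-iut-w5-d240; no definitions, no instances, no named facts).
`TemperedPiTowerNonabelianLevel.lean` proved the André tower property `htower₀` of `π₁^temp(𝒢)`
(cofinal open normal `N` with `π₁^temp(𝒢)/N ⊇` a free, normal, finite-index, finite-rank, NON-ABELIAN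
subgroup) for every `𝒢` in the class of Prop. 3.6 with finitely many vertices and edges and ONE CLOSED
EDGE.  This file proves the converse half, making the hypothesis exact:

* `IsFreeGroupoid.subsingleton_end_of_card` — the vertex group of a free groupoid with
  `#(generating arrows) + 1 ≤ #objects` at an object reaching every object is TRIVIAL (the
  spanning-tree basis `treeBasis` is indexed by the empty type `LoopIndex`, `card_loopIndex_add_card`);
* `CovObj.subsingleton_fundamentalGroup_of_forall_not_isClosedEdge` — if `𝔾` has no closed edge, then
  for every finite covering `S` the abutting branches of `𝔾_S` inject into its edges, so the graph
  fundamental group `π₁(𝔾_S, [x])` is trivial ("`𝔾_S` is a tree": one vertex-orbit carrying cusps);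
* `CovObj.finite_aut_univCoverOver_of_subsingleton` — then `Gal(𝒢_{∞,S}/𝒢) = Aut(𝒢_{∞,S})` is FINITE
  (the deck exact sequence `1 → π₁(𝔾_S) → Aut(𝒢_{∞,S}) → Aut(𝒢_S)`, `range_deckHom_eq_ker`,
  `finite_aut_of_rigid`);
* `ProfiniteSemiGraph.temperedPi_compactSpace_of_forall_not_isClosedEdge` — hence the model
  `𝒢.temperedPi h36 = lim_n Gal(𝒢_{∞,n}/𝒢)` is a closed subgroup of a product of finite groups: COMPACT
  (`CountableDiscreteSystem.compactSpace_limit`); `TemperedPiChart.compactSpace_of_forall_not_isClosedEdge`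
  — so is every chart (`nonempty_continuousMulEquiv_temperedPi`, Prop. 3.2 / Rmk. 3.2.1);
* `not_tower_of_compactSpace` — a compact group never has the tower property (an open normal subgroup
  has finite quotient, and a free group containing two non-commuting elements is infinite);
* `TemperedPiChart.tower_iff_exists_isClosedEdge`, `TemperedPiChart.compactSpace_iff_forall_not_isClosedEdge`
  (and the model forms) — **for `𝒢` in the class of Prop. 3.6 with finitely many vertices and edges,
  `π₁^temp(𝒢)` has the André tower property iff `𝔾` has a closed edge, and is compact iff `𝔾` has none.**

Consumers: the cell's [SemiAnbd] §6 / [EtTh] Lem. 2.17 (ii) reductions, which take `htower₀` BY NAME —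
this file says exactly for which finite `𝒢` the model supplies it.  Classical material (2006); nothing
here bears on [IUTchIII] Cor. 3.12 or takes a side on any disputed claim.
-/

noncomputable section

/-! ### 1. Free groupoids: trivial vertex groups below the tree threshold -/

namespace Literature.GroupTheory.CombinatorialGroupTheory

open CategoryTheory Quiver _root_.IsFreeGroupoid FreeGroupoidTree

universe u

/- As in `FreeGroupoidRank.lean`: type synonyms for the objects of the groupoid are unfolded by
unification. -/
set_option backward.isDefEq.respectTransparency false in
/-- **A free groupoid with `#(generating arrows) + 1 ≤ #objects` has trivial vertex groups** at every
object `r` from which all objects are reachable: the spanning-tree (Schreier) basis of `End r` along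
the geodesic arborescence rooted at `r` is indexed by the generating arrows outside the tree, of which
there are `#arrows + 1 - #objects = 0` (`card_loopIndex_add_card`); a group freely generated by the
empty type is trivial (Serre, *Trees*, I §3: `π₁` of a finite tree).
[cite: LyndonSchupp2001, Ch. I Prop. 3.9] -/
theorem IsFreeGroupoid.subsingleton_end_of_card {Y : Type u} [Groupoid.{u} Y] [IsFreeGroupoid Y]
    (r : Y) (h : ∀ a : Y, Nonempty (r ⟶ a)) [Finite Y] [Finite (Total (Generators Y))]
    (hcard : Nat.card (Total (Generators Y)) + 1 ≤ Nat.card Y) : Subsingleton (End r) := by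
  haveI := IsFreeGroupoid.rootedConnected_of_nonempty_hom r h
  let T := Quiver.geodesicSubtree (show Symmetrify (Generators Y) from r)
  haveI : Finite (LoopIndex T) := FreeGroupoidTree.finite_loopIndex T
  have hc := FreeGroupoidRank.card_loopIndex_add_card T
  have h0 : Nat.card (LoopIndex T) = 0 := by omega
  haveI : IsEmpty (LoopIndex T) :=
    (Nat.card_eq_zero.mp h0).resolve_right (not_infinite_iff_finite.mpr inferInstance)
  -- `End r = End (rootObj T)` is freely generated by the empty type `LoopIndex T`
  exact (treeBasis T).repr.toEquiv.subsingleton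

end Literature.GroupTheory.CombinatorialGroupTheory

namespace Literature.AnabelianGeometry.SemiGraphs

open CategoryTheory
open _root_.Topology
open Literature.GroupTheory.CombinatorialGroupTheory

universe u

/-! ### 2. Compact groups never have the André tower property -/

/-- **A compact topological group does not have the tower property `htower₀`.**  An open normal
subgroup `N` of a compact group has finite (compact, discrete) quotient `P/N`; a free subgroup `G` of a
finite group is finite, so each of its elements has finite order, and free groups are torsion-free
(Mathlib's `IsMulTorsionFree (FreeGroup _)` along `IsFreeGroup.toFreeGroup`): `G` is trivial and cannot
contain two non-commuting elements. [cite: MochizukiSemiAnbd2006, Prop 3.6 p.38] -/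
theorem not_tower_of_compactSpace {P : Type u} [Group P] [TopologicalSpace P] [IsTopologicalGroup P]
    [CompactSpace P] :
    ¬ (∀ U ∈ 𝓝 (1 : P), ∃ N : OpenNormalSubgroup P, (N : Set P) ⊆ U ∧
      ∃ (G : Subgroup (P ⧸ N.toSubgroup)) (_ : IsFreeGroup G), G.Normal ∧ G.FiniteIndex ∧
        Finite (IsFreeGroup.Generators G) ∧ ∃ a ∈ G, ∃ b ∈ G, a * b ≠ b * a) := by
  intro h
  obtain ⟨N, -, G, hG, -, -, -, a, ha, b, hb, hab⟩ := h Set.univ Filter.univ_mem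
  haveI : N.toSubgroup.Normal := N.isNormal'
  haveI : DiscreteTopology (P ⧸ N.toSubgroup) :=
    QuotientGroup.discreteTopology N.toOpenSubgroup.isOpen
  haveI : Finite (P ⧸ N.toSubgroup) := finite_of_compact_of_discrete
  haveI := hG
  -- `a ≠ 1` since `a` and `b` do not commute
  have ha1 : (⟨a, ha⟩ : G) ≠ 1 := by
    intro h1
    have h1' : a = 1 := congrArg Subtype.val h1
    exact hab (by rw [h1', one_mul, mul_one])
  -- but `a` has finite order in the finite group `G`, and free groups are torsion-free
  obtain ⟨m, hm, hpow⟩ := (isOfFinOrder_iff_pow_eq_one.mp (isOfFinOrder_of_finite (⟨a, ha⟩ : G)))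
  have h2 : IsFreeGroup.toFreeGroup G ⟨a, ha⟩ ^ m = 1 := by rw [← map_pow, hpow, map_one]
  rw [pow_eq_one_iff_left hm.ne'] at h2
  exact ha1 ((IsFreeGroup.toFreeGroup G).injective (h2.trans (map_one _).symm))

/-- The tower property forces non-compactness (contrapositive of `not_tower_of_compactSpace`).
[cite: MochizukiSemiAnbd2006, Prop 3.6 p.38] -/
theorem not_compactSpace_of_tower {P : Type u} [Group P] [TopologicalSpace P] [IsTopologicalGroup P]
    (htower₀ : ∀ U ∈ 𝓝 (1 : P), ∃ N : OpenNormalSubgroup P, (N : Set P) ⊆ U ∧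
      ∃ (G : Subgroup (P ⧸ N.toSubgroup)) (_ : IsFreeGroup G), G.Normal ∧ G.FiniteIndex ∧
        Finite (IsFreeGroup.Generators G) ∧ ∃ a ∈ G, ∃ b ∈ G, a * b ≠ b * a) :
    ¬ CompactSpace P := fun _ => not_tower_of_compactSpace htower₀

namespace ProfiniteSemiGraph

/-! ### 3. No closed edge downstairs: the graphs `𝔾_S` of finite coverings have trivial `π₁` -/

section OrbitGraph

variable {𝒢 : ProfiniteSemiGraph.{u}} (S : CovObj 𝒢)

/-- Two abutting branches of one NON-CLOSED edge coincide (a non-closed edge has verticial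
cardinality `< 2`, every edge having exactly two branches). [cite: MochizukiSemiAnbd2006, §1 p.12] -/
theorem _root_.Literature.AnabelianGeometry.SemiGraphs.SemiGraph.branch_eq_of_not_isClosedEdge
    {G : SemiGraph.{u}} {b b' : G.Branch} (he : G.edgeOf b' = G.edgeOf b)
    (hb : (G.abuts b).isSome) (hb' : (G.abuts b').isSome) (hcl : ¬ G.IsClosedEdge (G.edgeOf b)) :
    b' = b := by
  by_contra hne
  apply hcl
  unfold SemiGraph.IsClosedEdge SemiGraph.vertCard
  refine Nat.card_eq_two_iff.mpr ⟨⟨b, rfl, hb⟩, ⟨b', he, hb'⟩, fun h => hne (congrArg Subtype.val h).symm,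
    Set.eq_univ_of_forall fun z => ?_⟩
  obtain ⟨b₁, b₂, -, -, -, hall⟩ := G.two_branches (G.edgeOf b)
  rcases hall z.1 z.2.1 with hz | hz <;> rcases hall b rfl with h₁ | h₁ <;>
    rcases hall b' he with h₂ | h₂
  all_goals first
    | exact absurd (h₂.trans h₁.symm) hne
    | (left; exact Subtype.ext (hz.trans h₁.symm))
    | (right; exact Subtype.ext (hz.trans h₂.symm))

/-- **If `𝔾` has no closed edge, the abutting branches of `𝔾_S` inject into its edges**, `(b, E) ↦ E`
(a branch of `𝔾_S` over `b` abuts only if `b` does, and each edge of `𝔾` has at most one abutting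
branch). [cite: MochizukiSemiAnbd2006, Def 3.5(i) p.37] -/
theorem CovObj.card_abutting_le_card_oEdge [Finite S.OEdge] [Finite S.orbitGraph.Branch]
    (hcl : ∀ e : 𝒢.graph.Edge, ¬ 𝒢.graph.IsClosedEdge e) :
    Nat.card {β : S.orbitGraph.Branch // (S.orbitGraph.abuts β).isSome} ≤ Nat.card S.OEdge := by
  refine Nat.card_le_card_of_injective (fun β => β.1.1.2) ?_
  rintro ⟨⟨⟨b, E⟩, hE⟩, hβ⟩ ⟨⟨⟨b', E'⟩, hE'⟩, hβ'⟩ (h : E = E')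
  subst h
  -- both `b` and `b'` abut (else the branch of `𝔾_S` over them would not)
  have hb : (𝒢.graph.abuts b).isSome := by
    by_contra hn
    rw [Option.not_isSome_iff_eq_none] at hn
    rw [S.orbitGraph_abuts_of_none b E hE hn] at hβ
    exact absurd hβ (by simp)
  have hb' : (𝒢.graph.abuts b').isSome := by
    by_contra hn
    rw [Option.not_isSome_iff_eq_none] at hn
    rw [S.orbitGraph_abuts_of_none b' E hE' hn] at hβ'
    exact absurd hβ' (by simp)
  have hbb : b' = b :=
    SemiGraph.branch_eq_of_not_isClosedEdge (hE'.symm.trans hE) hb hb' (hcl _)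
  subst hbb
  rfl

/-- **If `𝔾` has no closed edge, the graph fundamental group `π₁(𝔾_S, c)` of every finite covering
`S` (over a semi-graph of anabelioids with finitely many vertices and edges) is trivial** at every
component `c` reaching all components: `#(abutting branches of 𝔾_S) + 1 ≤ #edges + #vertices` by
`card_abutting_le_card_oEdge` and one vertex-orbit, so `IsFreeGroupoid.subsingleton_end_of_card`
applies to the fundamental groupoid ("the fundamental group of any graph is free", here of rank `0`).
[cite: MochizukiSemiAnbd2006, §1 p.20] -/
theorem CovObj.subsingleton_fundamentalGroup_of_forall_not_isClosedEdge [Finite 𝒢.graph.Vertex]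
    [Finite 𝒢.graph.Edge] (hS : S.IsFinite) (hcl : ∀ e : 𝒢.graph.Edge, ¬ 𝒢.graph.IsClosedEdge e)
    (hV : Nonempty S.OVertex) (c : S.orbitGraph.CatCarrier)
    (hc : ∀ a : S.orbitGraph.CatCarrier, Nonempty (S.orbitGraph.basept c ⟶ S.orbitGraph.basept a)) :
    Subsingleton (S.orbitGraph.FundamentalGroup c) := by
  haveI : Finite S.orbitGraph.Vertex := S.finite_oVertex hS
  haveI : Finite S.orbitGraph.Edge := S.finite_oEdge hS
  haveI : Finite S.orbitGraph.Branch := S.finite_orbitGraph_branch hS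
  haveI : Finite S.OEdge := S.finite_oEdge hS
  haveI : Finite S.OVertex := S.finite_oVertex hS
  haveI := SemiGraph.finite_total_generators_fundamentalGroupoid S.orbitGraph
  haveI : Finite S.orbitGraph.FundamentalGroupoid :=
    Finite.of_equiv (S.orbitGraph.Vertex ⊕ S.orbitGraph.Edge)
      ⟨fun x => ⟨x⟩, fun a => a.as, fun _ => rfl, fun _ => rfl⟩
  have h : ∀ a : S.orbitGraph.FundamentalGroupoid, Nonempty (S.orbitGraph.basept c ⟶ a) :=
    fun a => hc a.as
  have hle := S.card_abutting_le_card_oEdge hcl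
  have hpos : 0 < Nat.card S.OVertex := Nat.card_pos
  have hcard : Nat.card (Quiver.Total (IsFreeGroupoid.Generators S.orbitGraph.FundamentalGroupoid)) + 1 ≤
      Nat.card S.orbitGraph.FundamentalGroupoid := by
    rw [SemiGraph.card_fundamentalGroupoid, SemiGraph.card_total_generators_fundamentalGroupoid]
    change _ ≤ Nat.card S.OVertex + Nat.card S.OEdge
    omega
  exact IsFreeGroupoid.subsingleton_end_of_card (S.orbitGraph.basept c) h hcard

end OrbitGraph

/-! ### 4. Trivial `π₁(𝔾_S)`: the Galois group of `𝒢_{∞,S}` is finite -/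

section Aut

variable {𝒢 : ProfiniteSemiGraph.{u}} (F : CovObj 𝒢) (v₀ : 𝒢.graph.Vertex) (x₀ : (F.SV v₀).obj.V)
  (h𝒢 : 𝒢.IsCountable)

/-- **`Gal(𝒢_{∞,F}/𝒢) = Aut(𝒢_{∞,F})` is finite when `π₁(𝔾_F, [x₀])` is trivial** (for `F` with finite
fibre `F_{v₀}`, point-transitive endomorphisms determined by their value at `x₀`, e.g. a connected
finite étale Galois covering): the deck exact sequence `1 → π₁(𝔾_F, [x₀]) → Aut(𝒢_{∞,F}) → Aut(F)`
(`range_deckHom_eq_ker`) makes the descent homomorphism injective into the finite group `Aut(F)`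
(`finite_aut_of_rigid`). [cite: MochizukiSemiAnbd2006, Prop 3.6 p.38] -/
theorem CovObj.finite_aut_univCoverOver_of_subsingleton [Finite ((F.SV v₀).obj.V)]
    (htrans : ∀ x : (F.SV v₀).obj.V, ∃ σ : F ⟶ F, (σ.fV v₀).hom.hom x₀ = x)
    (hrigid : ∀ σ σ' : F ⟶ F, (σ.fV v₀).hom.hom x₀ = (σ'.fV v₀).hom.hom x₀ → σ = σ')
    (hπ : Subsingleton (F.orbitGraph.FundamentalGroup (F.baseComp v₀ x₀))) :
    Finite (Aut (F.univCoverOver (F.baseComp v₀ x₀) h𝒢)) := by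
  haveI : Finite (Aut F) := CovObj.finite_aut_of_rigid F v₀ x₀ hrigid
  refine Finite.of_injective (CovObj.autDescendHom F v₀ x₀ h𝒢 htrans hrigid)
    ((MonoidHom.ker_eq_bot_iff _).mp ?_)
  rw [← CovObj.range_deckHom_eq_ker F v₀ x₀ h𝒢 htrans hrigid, MonoidHom.range_eq_bot_iff]
  exact MonoidHom.ext fun γ => by rw [Subsingleton.elim γ 1, map_one, MonoidHom.one_apply]

end Aut

/-! ### 5. The model `π₁^temp(𝒢) = lim_n Gal(𝒢_{∞,n}/𝒢)` is compact -/

namespace GaloisLevelData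

variable {𝒢 : ProfiniteSemiGraph.{u}} (D : GaloisLevelData 𝒢) (h𝒢 : 𝒢.IsCountable)

/-- **`lim_n Gal(𝒢_{∞,n}/𝒢)` is compact when every `Gal(𝒢_{∞,n}/𝒢)` is finite**: the limit is a
closed subgroup of the product of the (then finite discrete) levels
(`CountableDiscreteSystem.compactSpace_limit`). [cite: MochizukiSemiAnbd2006, Prop 3.6(i) p.38] -/
theorem compactSpace_temperedPi_of_finite (hfin : ∀ n, Finite (D.Gal h𝒢 n)) :
    CompactSpace (D.temperedPi h𝒢) := by
  haveI : ∀ i : (D.system h𝒢).ι, Finite ((D.system h𝒢).obj i) := fun i => hfin i.down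
  exact CountableDiscreteSystem.compactSpace_limit (D.system h𝒢)

end GaloisLevelData

section Model

variable (𝒢 : ProfiniteSemiGraph.{u}) (h36 : 𝒢.Prop36Hypotheses)

/-- **The Galois groups `Gal(𝒢_{∞,n}/𝒢)` of the model tower are finite when `𝔾` has no closed edge**
(`𝒢` in the class of Prop. 3.6 with finitely many vertices and edges): the levels `𝒢_n` are connected
finite étale Galois coverings, so `π₁(𝔾_n, [x_n])` is trivial
(`subsingleton_fundamentalGroup_of_forall_not_isClosedEdge`, reachability
`galoisLevelData_nonempty_hom_baseComp`) and `finite_aut_univCoverOver_of_subsingleton` applies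
(rigidity `hrigid_ofBObj_of_isConnected`, finiteness `ofBObj_isFinite`).
[cite: MochizukiSemiAnbd2006, Prop 3.6 p.38] -/
theorem galoisLevelData_finite_Gal_of_forall_not_isClosedEdge [Finite 𝒢.graph.Vertex]
    [Finite 𝒢.graph.Edge] (hcl : ∀ e : 𝒢.graph.Edge, ¬ 𝒢.graph.IsClosedEdge e) (n : ℕ) :
    Finite ((𝒢.galoisLevelData h36).Gal h36.isCountable n) := by
  letI := 𝒢.toAnab.galoisCategory_bObj ⟨h36.isConnected⟩
  let D := 𝒢.galoisLevelData h36
  have hS : (D.S n).IsFinite := 𝒢.ofBObj_isFinite (𝒢.tower h36 n)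
  haveI : Finite (((D.S n).SV D.v₀).obj.V) := hS.finite_V _
  have hsub : Subsingleton ((D.S n).orbitGraph.FundamentalGroup ((D.S n).baseComp D.v₀ (D.x n))) :=
    (D.S n).subsingleton_fundamentalGroup_of_forall_not_isClosedEdge hS hcl ⟨Quot.mk _ ⟨D.v₀, D.x n⟩⟩
      _ (𝒢.galoisLevelData_nonempty_hom_baseComp h36 n)
  exact CovObj.finite_aut_univCoverOver_of_subsingleton (D.S n) D.v₀ (D.x n) h36.isCountable
    (fun x => D.htrans n D.v₀ (D.x n) x)
    (fun σ σ' h => 𝒢.hrigid_ofBObj_of_isConnected h36.isConnected _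
      (𝒢.isGalois_tower h36 n).toIsConnected _ _ σ σ' h)
    hsub

/-- **[SemiAnbd] Prop. 3.6 at the model: `π₁^temp(𝒢)` is COMPACT when `𝔾` has no closed edge**
(`𝒢` in the class of Prop. 3.6 with finitely many vertices and edges): all `Gal(𝒢_{∞,n}/𝒢)` are
finite, so `𝒢.temperedPi h36 = lim_n Gal(𝒢_{∞,n}/𝒢)` is a closed subgroup of a compact product —
i.e. `π₁^temp(𝒢)` is profinite (it is its own profinite completion `π̂₁(𝒢)`).
[cite: MochizukiSemiAnbd2006, Prop 3.6(i) p.38] -/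
theorem temperedPi_compactSpace_of_forall_not_isClosedEdge [Finite 𝒢.graph.Vertex]
    [Finite 𝒢.graph.Edge] (hcl : ∀ e : 𝒢.graph.Edge, ¬ 𝒢.graph.IsClosedEdge e) :
    CompactSpace (𝒢.temperedPi h36) :=
  (𝒢.galoisLevelData h36).compactSpace_temperedPi_of_finite h36.isCountable
    (𝒢.galoisLevelData_finite_Gal_of_forall_not_isClosedEdge h36 hcl)

/-- At the model: no closed edge ⇒ the André tower property FAILS for `𝒢.temperedPi h36`.
[cite: MochizukiSemiAnbd2006, Prop 3.6(i) p.38] -/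
theorem temperedPi_not_tower_of_forall_not_isClosedEdge [Finite 𝒢.graph.Vertex]
    [Finite 𝒢.graph.Edge] (hcl : ∀ e : 𝒢.graph.Edge, ¬ 𝒢.graph.IsClosedEdge e) :
    ¬ (∀ U ∈ 𝓝 (1 : 𝒢.temperedPi h36), ∃ N : OpenNormalSubgroup (𝒢.temperedPi h36),
      (N : Set (𝒢.temperedPi h36)) ⊆ U ∧
      ∃ (G : Subgroup (𝒢.temperedPi h36 ⧸ N.toSubgroup)) (_ : IsFreeGroup G), G.Normal ∧
        G.FiniteIndex ∧ Finite (IsFreeGroup.Generators G) ∧ ∃ a ∈ G, ∃ b ∈ G, a * b ≠ b * a) := by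
  haveI := 𝒢.temperedPi_compactSpace_of_forall_not_isClosedEdge h36 hcl
  exact not_tower_of_compactSpace

/-- **[SemiAnbd] Prop. 3.6 / [André 2003] §4.5 at the model, exact form: `π₁^temp(𝒢)` has the
André tower property `htower₀` IFF `𝔾` has a closed edge** (`𝒢` in the class of Prop. 3.6 with
finitely many vertices and edges; `⇐` is `temperedPi_tower_of_isClosedEdge`).
[cite: MochizukiSemiAnbd2006, Prop 3.6(i) p.38] -/
theorem temperedPi_tower_iff_exists_isClosedEdge [Finite 𝒢.graph.Vertex] [Finite 𝒢.graph.Edge] :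
    (∀ U ∈ 𝓝 (1 : 𝒢.temperedPi h36), ∃ N : OpenNormalSubgroup (𝒢.temperedPi h36),
      (N : Set (𝒢.temperedPi h36)) ⊆ U ∧
      ∃ (G : Subgroup (𝒢.temperedPi h36 ⧸ N.toSubgroup)) (_ : IsFreeGroup G), G.Normal ∧
        G.FiniteIndex ∧ Finite (IsFreeGroup.Generators G) ∧ ∃ a ∈ G, ∃ b ∈ G, a * b ≠ b * a) ↔
    ∃ e : 𝒢.graph.Edge, 𝒢.graph.IsClosedEdge e := by
  constructor
  · intro h
    by_contra hne
    push Not at hne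
    exact 𝒢.temperedPi_not_tower_of_forall_not_isClosedEdge h36 hne h
  · exact 𝒢.temperedPi_tower_of_isClosedEdge h36

/-- At the model: **`π₁^temp(𝒢)` is compact IFF `𝔾` has no closed edge** (a closed edge gives the
tower property, which forbids compactness). [cite: MochizukiSemiAnbd2006, Prop 3.6(i) p.38] -/
theorem temperedPi_compactSpace_iff_forall_not_isClosedEdge [Finite 𝒢.graph.Vertex]
    [Finite 𝒢.graph.Edge] :
    CompactSpace (𝒢.temperedPi h36) ↔ ∀ e : 𝒢.graph.Edge, ¬ 𝒢.graph.IsClosedEdge e := by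
  constructor
  · intro hc e he
    exact not_compactSpace_of_tower (𝒢.temperedPi_tower_of_isClosedEdge h36 ⟨e, he⟩) hc
  · exact 𝒢.temperedPi_compactSpace_of_forall_not_isClosedEdge h36

end Model

/-! ### 6. Every chart -/

section Chart

variable {𝒢 : ProfiniteSemiGraph.{u}} (c : TemperedPiChart 𝒢)

/-- **Every chart of `π₁^temp(𝒢)` is compact when `𝔾` has no closed edge** (transport from the model
along `nonempty_continuousMulEquiv_temperedPi`, Prop. 3.2 / Rmk. 3.2.1).
[cite: MochizukiSemiAnbd2006, Prop 3.6(ii) p.38] -/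
theorem TemperedPiChart.compactSpace_of_forall_not_isClosedEdge (h36 : 𝒢.Prop36Hypotheses)
    [Finite 𝒢.graph.Vertex] [Finite 𝒢.graph.Edge] (hcl : ∀ e : 𝒢.graph.Edge, ¬ 𝒢.graph.IsClosedEdge e) : CompactSpace c.G := by
  obtain ⟨e⟩ := c.nonempty_continuousMulEquiv_temperedPi h36
  haveI := 𝒢.temperedPi_compactSpace_of_forall_not_isClosedEdge h36 hcl
  exact e.toHomeomorph.compactSpace

/-- For every chart: no closed edge ⇒ the André tower property FAILS — the closed-edge hypothesis of
`TemperedPiChart.tower_of_isClosedEdge` cannot be dropped. [cite: MochizukiSemiAnbd2006, Prop 3.6 p.38] -/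
theorem TemperedPiChart.not_tower_of_forall_not_isClosedEdge (h36 : 𝒢.Prop36Hypotheses)
    [Finite 𝒢.graph.Vertex] [Finite 𝒢.graph.Edge] (hcl : ∀ e : 𝒢.graph.Edge, ¬ 𝒢.graph.IsClosedEdge e) :
    ¬ (∀ U ∈ 𝓝 (1 : c.G), ∃ N : OpenNormalSubgroup c.G, (N : Set c.G) ⊆ U ∧
      ∃ (G : Subgroup (c.G ⧸ N.toSubgroup)) (_ : IsFreeGroup G), G.Normal ∧ G.FiniteIndex ∧
        Finite (IsFreeGroup.Generators G) ∧ ∃ a ∈ G, ∃ b ∈ G, a * b ≠ b * a) := by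
  haveI := c.compactSpace_of_forall_not_isClosedEdge h36 hcl
  exact not_tower_of_compactSpace

/-- **[SemiAnbd] Prop. 3.6 / [André 2003] §4.5 for EVERY chart, exact form: the group `c.G` of a
tempered fundamental group chart of `𝒢` (class of Prop. 3.6, finitely many vertices and edges) has
the André tower property `htower₀` — cofinal open normal `N` with `c.G/N ⊇` a free, normal,
finite-index, finite-rank, non-abelian subgroup — IFF the underlying semi-graph `𝔾` has a closed
edge.** (`⇐`: `TemperedPiChart.tower_of_isClosedEdge`; `⇒`: this file.)  This is the exact range of
the model-level supply of the input `htower₀` of the cell's [SemiAnbd] §6 / [EtTh] Lem. 2.17 (ii)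
reductions. [cite: MochizukiSemiAnbd2006, Prop 3.6 p.38] -/
theorem TemperedPiChart.tower_iff_exists_isClosedEdge (h36 : 𝒢.Prop36Hypotheses)
    [Finite 𝒢.graph.Vertex] [Finite 𝒢.graph.Edge] :
    (∀ U ∈ 𝓝 (1 : c.G), ∃ N : OpenNormalSubgroup c.G, (N : Set c.G) ⊆ U ∧
      ∃ (G : Subgroup (c.G ⧸ N.toSubgroup)) (_ : IsFreeGroup G), G.Normal ∧ G.FiniteIndex ∧
        Finite (IsFreeGroup.Generators G) ∧ ∃ a ∈ G, ∃ b ∈ G, a * b ≠ b * a) ↔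
    ∃ e : 𝒢.graph.Edge, 𝒢.graph.IsClosedEdge e := by
  constructor
  · intro h
    by_contra hne
    push Not at hne
    exact c.not_tower_of_forall_not_isClosedEdge h36 hne h
  · exact c.tower_of_isClosedEdge h36

/-- For every chart: **`c.G` is compact IFF `𝔾` has no closed edge.**
[cite: MochizukiSemiAnbd2006, Prop 3.6 p.38] -/
theorem TemperedPiChart.compactSpace_iff_forall_not_isClosedEdge (h36 : 𝒢.Prop36Hypotheses)
    [Finite 𝒢.graph.Vertex] [Finite 𝒢.graph.Edge] :
    CompactSpace c.G ↔ ∀ e : 𝒢.graph.Edge, ¬ 𝒢.graph.IsClosedEdge e := by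
  constructor
  · intro hc e he
    exact not_compactSpace_of_tower (c.tower_of_isClosedEdge h36 ⟨e, he⟩) hc
  · exact c.compactSpace_of_forall_not_isClosedEdge h36

end Chart

end ProfiniteSemiGraph

end Literature.AnabelianGeometry.SemiGraphs

end
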